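import Mathlib
import HarnessLib
import HarnessLib.Audit
import Summits.ValiantsHypothesis.Statement
import Literature.Computability.AlgebraicComplexity.DeterminantalComplexity

/-!
Route: IntegralOrbits

DORMANT since 2026-09-03T13:36:53Z (reconciler: no traction for 5 d (last activity statement-checked at 2026-08-29T12:54:02Z); parked, not closed — `ledger route dormant route-ValiantsHypothesis-IntegralOrbits --off` to reactivate) — unstaffed, not closed; items shared with open routes are served there. `ledger route dormant <id> --off` reactivates.

# Route IntegralOrbits — rational character ⇒ integral regular model — constant elimination for
determinantal expressions via orders

It suffices to show X = IntDetQP ("SIGN DETERMINANTS FOR THE PERMANENT"): if VP ℂ = VNP ℂ then for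
all large n some nonzero
integer multiple of a power of the permanent, N·per_n^d (d ≥ 1), is the determinant of a matrix of
affine forms with ALL
COEFFICIENTS IN {−1,0,1} and of quasi-polynomial size m ≤ 2^((log₂ n + c)^c). X is the constant-free
face of "VP ⇒ dc
quasi-polynomial": it says the complex constants of a small determinantal expression of per_n can be
traded for size, up to a
power and an integer factor. With the Shub–Smale τ-conjecture and Bürgisser's theorem re-run at
quasi-polynomial granularity
(TauBurgisserDet) X contradicts VP ℂ = VNP ℂ. Realises card integral-orbits-reduction-theory-tau
(spine; its (B)–(E) become the
single order-theoretic crux IntegralCharacterLift, its (A) becomes RationalCharacterNF), and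
supplies the missing engine for
TauConst.TauConstElim (stmt-ValiantsHypothesis-0335) in qp/power form and for
hilbert90-descent-rigidity-rationality (C3).
Lean: `Literature.Computability.AlgebraicComplexity.VP ℂ =
Literature.Computability.AlgebraicComplexity.VNP ℂ → ∃ c n₀ : ℕ, ∀ n ≥ n₀, ∃ (m d : ℕ) (N : ℤ) (A :
Matrix (Fin m) (Fin m) (MvPolynomial (Fin n × Fin n) ℤ)), 1 ≤ d ∧ m ≤ 2 ^ ((Nat.log 2 n + c) ^ c) ∧
N ≠ 0 ∧ (∀ i j, (A i j).totalDegree ≤ 1) ∧ (∀ i j s, |MvPolynomial.coeff s (A i j)| ≤ 1) ∧ A.det =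
MvPolynomial.C N * Literature.Computability.AlgebraicComplexity.perPoly (Fin n) ℤ ^ d`

## Assembly
Deciding theorem `closes : IntDetQP → TauConjecture → TauBurgisserDet → ValiantsHypothesis` (pure
logic, native-certified):
ValiantsHypothesis is VP ℂ ≠ VNP ℂ; assume VP ℂ = VNP ℂ; IntDetQP gives the sign-determinant
conclusion; TauBurgisserDet applied
to TauConjecture denies it; contradiction. The Assembly ITEM is the full two-layer assembly
RationalCharacterNF →
IntegralCharacterLift → HeightToSize → TauConjecture → TauBurgisserDet → ValiantsHypothesis
(restated 2026-08-16: the earlier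
three-hypothesis form coincided with `closes` and was flagged tauto-trivial by h21_ground): the
engine cruxes and HeightToSize
yield IntDetQP through the layer-1 glue IntDetGlue (normal form; lift at ι = Fin n × Fin n;
substitute X₀ ↦ 1, X_v ↦ x_v − δ_v;
clear N^e; descend ℂ → ℤ; compress heights — landed as Theorems.intDetGlue_proof), then `closes`
finishes, exactly as
RigidMinimalReps/DivisionGap feed their X; TauConjecture is the shared decl of route TauConst.

Rationale: WHY THIS LINE. Mechanism (arithmetic invariant theory, but through ORDERS rather than p-adic
Kempf–Ness): normalise an expression as
A(x) = A(I)·(1 + Σ_v (x_v − δ_v) M_v) using per_n(I) = 1, so that only the tuple (M_v) up to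
simultaneous conjugation matters and
its invariants are the CHARACTER w ↦ tr(M_{w₁}⋯M_{w_ℓ}) (Lebruyn2008 Thm 1.6 = Procesi 1976 FFT;
closed orbits = semisimple tuples,
Lebruyn2008 Thm 2.3 = Artin 1969). If the character is ℚ-valued, ℤ[1/N]-valued and of controlled
growth, the ℤ[1/N]-span Λ of
the words is an ORDER in the central simple ℚ-algebra spanned by the words (nondegenerate trace form
⇒ Λ ⊆ Λ^# finitely generated,
McconnellRobson2001 §5.3.8–3.12, §13.6.10), Λ^# is a Λ-stable free ℤ[1/N]-lattice of rank m², and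
the LEFT-REGULAR
representation on it is an INTEGRAL tuple of small height computing per_n^m: the Brauer obstruction
found by the card's audit
(no rational point in the orbit) is absorbed by the regular representation, strong approximation is
replaced by "orders over a
PID preserve a free lattice", and Siegel reduction by Hermite normal form inside the dual of a word
basis. What is imported:
noncommutative arithmetic (orders, trace forms, Cayley–Hamilton algebras) and GIT of matrix tuples;
the endgame is the
Diophantine τ-line of TauConst (ShubSmale1995, Burgisser2009, arXiv:2406.06217 Thm 4.17). What it
does that TauConst / BoolTransfer /
NumTame do not: it DECOMPOSES the constant problem (Burgisser2000 Ch. 4; arXiv:2606.25121 §1.2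
"converse unclear"; arXiv:2601.00387
§2.1 "divisions by two occur") into a provable integrality-and-height engine plus one sharply stated
Diophantine residue — the
rationality and height of the CHARACTER of a small expression — instead of positing constant
elimination wholesale.

RANKED CRUXES. #0 IntDetQP (target) — VP ℂ = VNP ℂ ⇒ ∃ c n₀, ∀ n ≥ n₀, ∃ m ≤ 2^((log₂ n + c)^c), d ≥
1, N ≠ 0 and an m×m matrix A of affine forms over ℤ in the n² variables with every coefficient in
{−1,0,1} and det A = N·per_n^d. (why it might fail: it is constant elimination for determinantal
expressions (open: arXiv:2606.25121 §1.2); per_n may have qp-size complex expressions while every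
sign expression of every N·per_n^d is exponential — exactly the failure of RationalCharacterNF.)
[arXiv:2606.25121, arXiv:2601.00387, Burgisser2000, Koiran2004, Burgisser2009]
#2 RationalCharacterNF (crux) — RATIONAL CHARACTER NORMAL FORM (card (A), Diophantine core): if
per_n has an affine determinantal expression of size m over ℂ, it has a normalised one det(1 + Σ_v
(x_v − δ_v) M_v) = per_n of size m' ≤ 2^((log₂ m + c)^c) whose tuple (M_v) is absolutely irreducible
(words span all matrices) and whose character tr(M_{w₁}⋯M_{w_ℓ}) lies in ℤ[1/N] with numerators ≤
2^(h(ℓ+1)), N-exponents ≤ h(ℓ+1), and N ≤ 2^h, h ≤ 2^((log₂ m + c)^c). [difficulty: open-problem]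
(why it might fail: nothing forces the moduli point of a small expression to be RATIONAL of small
height: Rep_m(per_n)//G may have only Galois-conjugate packets (then only the number-field version
holds) or only points of astronomic height (Hilbert-10-type behaviour); no existence principle is
known.) [Burgisser2000, arXiv:2606.25121, Lebruyn2008, arXiv:1411.6786,
doi:10.1007/978-1-4939-1590-3_3, MignonRessayre2004]
#3 IntegralCharacterLift (crux) — INTEGRAL CHARACTER LIFT (card (B)+(C)+(D)+(E) in one statement):
an absolutely irreducible tuple M : ι → M_m(ℂ) whose character is ℤ[1/N]-valued with numerators ≤
2^(h(ℓ+1)) and N-exponents ≤ h(ℓ+1) (1 ≤ N ≤ 2^h) admits integer matrices Z_v of size m² with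
|entries| ≤ 2^((m+#ι+h+2)^c) and e ≤ (m+#ι+h+2)^c such that the generic pencil determinant det(X₀·1
+ Σ_v X_v Z_v/N^e) equals det(X₀·1 + Σ_v X_v M_v)^r for some r ≥ 1 (proof route: Λ = ℤ[1/N]⟨words⟩ ⊆
Λ^# is an order, left-regular representation on the Λ-stable free lattice Λ^#, r = m). [difficulty:
L] (why it might fail: the qualitative lift is order theory; the risk is the EFFECTIVE part — the
Λ-stable lattice is the first stall of the dual chain L_ℓ^#, ℓ ≤ m² + log₂[L^#:L], and the
HNF/Gram-determinant bookkeeping must stay polynomial in m+#ι+h (else restate with a worse but still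
sufficient bound).) [McconnellRobson2001, Lebruyn2008, Reiner2003MaximalOrders, CurtisReiner1962,
doi:10.1007/978-1-4939-1590-3_3]
#4 TauBurgisserDet (crux) — Bürgisser's theorem in the form the assembly needs: the τ-conjecture
implies that NO c, n₀ give, for all n ≥ n₀, sign determinantal expressions of size ≤ 2^((log₂ n +
c)^c) of some N·per_n^d (N ≠ 0, d ≥ 1) — i.e. Burgisser2009 Thm 1.1/1.2 re-run at quasi-polynomial
granularity with powers (Boolean side: exact d-th root of per(x)^d ≥ 0 on 0/1 matrices; algebraic
side: (2^p·PW_{2^ℓ})^d·N keeps its 2^ℓ integer roots) and with the multiplier N as advice.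
[difficulty: XL] (why it might fail: only if a step of Burgisser2009 is genuinely polynomial-only:
the CH collapse needs #P ⊆ qpSIZE ⇒ CH ⊆ qpSIZE (qp∘qp = qp, fine) and the constant-free
completeness of per up to 2^p(n) (Koiran2004 Thm 4.3) must be re-run for qp-size VNP⁰-type families;
unverified in print.) [Burgisser2009, Koiran2004, arXiv:2406.06217, ShubSmale1995, arXiv:2601.00387]
#5 TauConjecture (crux) — the Shub–Smale τ-conjecture (shared verbatim with TauConst.TauConjecture =
stmt-ValiantsHypothesis-0336): the number of distinct integer roots of a nonzero f ∈ ℤ[T] is ≤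
(τ(f)+2)^c, τ = constantFreeComplexity of f transported to MvPolynomial (Fin 1) ℤ. [difficulty:
open-problem] (why it might fail: false if ∏_{i≤n}(T−i) or some m_n·n! has constant-free SLPs of
length (log n)^O(1) (open; best τ(n!) = O(√n log² n)); the real-zero analogue IS false (Chebyshev,
barrier TauRealZeros), so integrality must be used.) [ShubSmale1995, BlumCuckerShubSmale1998,
arXiv:2406.06217, Koiran2011]
#9 HeightToSize (support) — HEIGHT IS FREE UP TO SIZE: an m×m affine determinantal expression over ℤ
(variables σ) with all coefficients bounded by 2^h of a polynomial f can be replaced by one of size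
≤ (m + #σ + h + 2)^c with all coefficients in {−1,0,1} (det → ABP with ±1 constants, binary
expansion of each edge constant as a series-parallel gadget, ABP → det with entries in {0,±1,±x},
sign fixed by a row swap). [difficulty: provable-now] [Valiant1979, MahajanVinay1997,
arXiv:2406.06217, Toda1991]
#9 IntDetGlue (support) — layer-1 glue: RationalCharacterNF → IntegralCharacterLift → HeightToSize →
IntDetQP. From VP ℂ = VNP ℂ get qp-bounded dc(per_n) (cone facts
isQPBounded_determinantalComplexity_of_isVPFamily_holds, hasDetRepr_determinantalComplexity_holds,
mem_VP_ofFintype_iff_holds, perFamily_mem_VNP_holds), apply the NF, lift (ι = Fin n × Fin n),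
substitute X₀ ↦ 1, X_v ↦ x_v − δ_v (det commutes with the ring hom), clear N^e row-wise (N' =
N^(e·m'²), d = r), descend from ℂ to ℤ by injectivity of MvPolynomial.map, and compress heights with
HeightToSize; compose the qp bounds. [difficulty: M] [BurgisserClausenShokrollahi1997,
MignonRessayre2004, Valiant1979]

TWO-LAYER PLAN. Foreseen glued splits (none filed now): RationalCharacterNF ⇐ WeakRationalCharacter
(any normalised expression, possibly
reducible, with ℚ-valued ℤ[1/N]-valued small character) → BlockReduction (semisimplify; per_n
irreducible + per_n(I) = 1 ⇒ exactly
one composition factor carries per_n, it is Galois-fixed, its character is ℚ-valued and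
ℤ[1/N]-integral by the p-adic power-sum
argument) → RationalCharacterNF. If refuters show the ℚ-version too strong: NF_K / Lift_K over a
number field K = ℚ(θ) of qp degree
(character in ℤ[θ][1/N], Lift via the trace form Tr_{K/ℚ}∘tr, output per_n^([K:ℚ]·m)), same
assembly. IntegralCharacterLift ⇐
OrderFinite (Λ ⊆ Λ^#, rank m²) → RegularModelHeight (HNF inside L^#, entries ≤ 2^poly) →
IntegralCharacterLift. TauBurgisserDet ⇐
BooleanCollapseQP (#P ⊆ qpSIZE from sign determinants of N·per^d) → PochhammerQP (CH ⊆ qpSIZE/qpoly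
+ Valiant's criterion +
Koiran2004 Thm 4.3 at qp size ⇒ τ((2^p PW_{2^ℓ})^d N) qp) → TauBurgisserDet.

KILL CRITERIA. Refutation of IntegralCharacterLift (an absolutely irreducible tuple with integral
bounded character admitting no small integral
regular model) kills the engine and closes the route (close --reason refuted:IntegralCharacterLift)
— but by the order argument this
should be impossible; a refutation would more likely expose a mis-typed bound, to be restated once.
Refutation of RationalCharacterNF at
small n (a size-m expression of per_n, m < 2^n − 1, such that NO expression of size ≤ qp(m) has
rational small character) is a
genuine kill of the line as a route to VH, and a striking theorem ("irrational constants are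
essential for the permanent") to be
recorded as negative knowledge; pivot: the number-field version (Two-layer plan). Refutation of
TauConjecture closes cruxes 4–5 and
moots the assembly (shared fate with TauConst, SqrtTowers); the engine (2, 3, HeightToSize,
IntDetGlue ⇒ IntDetQP) survives as input
to BoolTransfer-type endgames (#P ⊆ qpSIZE). TauConstElim (stmt-0335) proved elsewhere by other
means makes this route's target a
corollary-strength variant; VH proved elsewhere moots it.

NOT DECOMPOSED YET. The word-length / Gram-determinant constants of the lift (children of
IntegralCharacterLift); the block-reduction lemma and the
number-field variant (children of RationalCharacterNF); the four Bürgisser steps at qp granularity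
(children of TauBurgisserDet) —
all layer-2, filed only when a crux closes or a refuter forces the K-version. No definition items:
every statement is elementary
(matrices, traces of words, MvPolynomial determinants). The archimedean twin (minimum-norm
representative bounded by the height of
the character, Kempf–Ness) is deliberately left to route ScaledPencil / card
kempf-ness-scaled-pencils.

CHEAPEST FALSIFIER. (1) Lookup/short proof: is IntegralCharacterLift with bound 2^poly(m,h) already
a stated theorem (integral forms of representations of
finitely generated algebras with integral character, à la Curtis–Reiner §75 for group algebras)? If
yes crux 3 is `known` and becomes
support — good for the route. (2) Computation (kit, not run here: hub compute is async and this is a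
one-shot seat): take Grenet's
7×7 expression of per_3 and random complex size-7 expressions obtained from it by G(ℂ)-conjugation
and by the known positive-dimensional
families of size-7 expressions (AlperBogartVelasco2017); compute characters on words of length ≤ 50:
every family member with
ℚ-valued character must, by the Lift, yield an integral 49×49 model — check numerically; and search
the ABV families for members with
irrational character values of trace words (they exist iff the moduli point moves), which calibrates
how non-trivial RationalCharacterNF
is already at n = 3.

NUMBERS. dc(per_n) ≤ 2^n − 1 with a 0/±1 INTEGER expression (Grenet2011) — the data point the line
must explain: its normalised tuple is integral
(A(I) unimodular), character integral, N = 1. dc(per_3) = 7 (AlperBogartVelasco2017). VP ⇒ dc(f_n) ≤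
2^(17A²(log₂ n+1)²) (tree:
isQPBounded_determinantalComplexity_of_isVPFamily_holds). Invariants of m×m tuples are generated by
traces of words of length ≤ m²+1
(Lebruyn2008 Thm 1.15, Razmyslov); words of length ≤ m²−1 span the generated algebra. Lift output:
size m², power r = m, height
2^poly(m)·h. Endgame slack: τ-conjecture needs 2^ℓ ≤ (τ+2)^c while the chain gives τ ≤ 2^polylog(ℓ)
— any quasi-polynomial bound in
X suffices. Items at open: 8 (target, assembly, 4 cruxes, 2 support).

DEFINITION REQUESTS. None. All statements are over Mathlib (Matrix, MvPolynomial, List words,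
Submodule.span) and existing tree declarations
(Literature.Computability.AlgebraicComplexity.HasDetRepr, perPoly, VP, VNP, constantFreeComplexity);
`lean check` of Sketch.lean rc 0.

Novelty: Searches (2026-08-15): `lit search --hybrid` (local, no_graph) "maximal orders trace form order
finitely generated central simple
algebra" (12 books: Le Bruyn 2008, McConnell–Robson 2001, DeMeyer–Ingraham …), "every representation
over the quotient field is
equivalent to an integral representation … PID" (10 generic algebra books), "constant-free circuits
permanent large integer constants
VP0 VNP0" (10, Landsberg 2017 pp. 203–205 nearest); `lit galaxy search --star all` "constant-free
determinantal complexity permanent"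
(0), "integral determinantal representation" (0), "determinantal representation with integer
coefficients" (0), "rational points on the
moduli space of determinantal representations" (0), `--star pdf` "determinantal complexity" (8
generic: Kumar–Saraf, GMQ boundaries,
Ikenmeyer slides); `lit frontier ValiantsHypothesis --since 2022` (30 rows; constants only in
arXiv:2601.00387, arXiv:2606.25121);
`lit bridges ValiantsHypothesis --cross any` (no arithmetic-invariant-theory bridge); remote
OpenAlex/S2/arXiv rate-limited (429) this
session; the card's audit-13 prior-art list (arXiv:1411.6786 Maculan, Burnol 1992,
Bost/Zhang/Gasbarri, doi:10.1007/978-1-4939-1590-3_3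
Bhargava–Gross) inherited.
Nearest prior art found: doi:10.1007/978-1-4939-1590-3_3 (Bhargava–Gross arithmetic invariant
theory: rational vs integral orbits for
specific representations), arXiv:1411.6786 (heights on GIT quotients, p-adic Kempf–Ness),
Lebruyn2008 / Artin–Procesi (orders and
Cayley–Hamil  [refs: 10.1007/978-1-4939-1590-3_3, 2601.00387, 2606.25121, 1411.6786, doi:10.1007/978-1-4939-1590-3_3, Lebruyn2008, Burgisser2000]

Barriers (technique_class: constant-elimination, integral-orbits, orders, tau): - technique_class: constant-elimination, integral-orbits, orders, tau
- Literature.Barriers.ValiantsHypothesis.TauRealZeros: applies to crux TauConjecture exactly as in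
TauConst (every RealZeroTauBound c is refuted by Chebyshev T_{2^k}; a proof of the τ-conjecture must
use integrality of the roots); the engine cruxes 2–3 are untouched by it.
- Literature.Barriers.ValiantsHypothesis.PermanentCharTwo: consistent, not evaded — a sign
expression of N·per_n^d reduces mod 2 to one of N·det_n^d (per = det over 𝔽₂), which exists
trivially; the line never argues in characteristic 2 (reductions mod odd p ∤ N of the integral model
are a by-product for BoolTransfer-type transfer, not used in the assembly).
- Literature.Barriers.ValiantsHypothesis.AlgebraicNaturalProofs: does not apply — no lower-bound
property of polynomials is constructed; the route is a transfer/normalisation engine plus the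
τ-conjecture.
- Literature.Barriers.ValiantsHypothesis.RankMethods: does not apply (no rank/flattening measure is
used).
- Uncatalogued, load-bearing: the constant barrier itself (TauConst.TauConstElim stmt-0335,
BoolTransfer.BoolGrhFree) — not evaded but DECOMPOSED: integrality, field of definition (Brauer
class) and height-in-orbit are discharged by IntegralCharacterLift; what remains is
RationalCharacterNF, and Hilbert-10-type phenomena warn it cannot follow from general principles —
the bet is on the specific, symmetric moduli space of expressions of per_n.
- Negatives index: empty at filing (`

Novelty grade: new-combination — ROUTE REVIEW (refuter rreview a895813f, 2026-08-15). Grade inherited from card audit-13/triage-13 (new-combination: arithmetic of matrix-tuple quotients × constant-free Valiant bookkeeping; nobody found pointing orders/trace rings at the constant problem); audit-13's Brauer correction is correctly a (refuter refuter-rreview-route-ValiantsHypothesis-a895813f-0, 2026-08-15T14:06:56Z; prior: doi:10.1007/978-1-4939-1590-3_3 Bhargava–Gross 2014 (rational vs integral orbits, H^1 / Brauer obstruction), arXiv:1411.6786 Maculan (heights on GIT quotients, p-adic Kempf–Ness), Lebruyn2008 / Artin–Procesi (orders and trace rings of matrix tuples); Curtis–Reiner §75-type integral forms via regular representation (qualitative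 Lift), doi:10.1007/s00037-009-0260-x Bürgisser 2009 Thm 1.1/1.2 + Koira)

History (route lifecycle, newest last):
- 2026-08-16T04:21:07Z · AUTO-CRUX (backfill): IntDetQP — hypotheses of the deciding theorem that nothing in the route derives are cruxes (operator:999:1085951)
- 2026-08-16T16:26:28Z · rev 2: restated Assembly (stmt-ValiantsHypothesis-7683 proved) — route-repair (ground-failed): restate Assembly (stmt-ValiantsHypothesis-7683). h21_ground flagged the old Assembly := IntDetQP → TauConjecture → TauBurgisserDet (planner-rground-ValiantsHypothesis-IntegralOrbi-5aa7c13a-0)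
- 2026-08-23T12:36:15Z · DORMANT — reconciler: no traction for 6.1 d (last activity item-evidence-added at 2026-08-17T10:11:02Z); parked, not closed — `ledger route dormant route-ValiantsHypothes (operator:999:3445284)
- 2026-08-29T10:41:01Z · REACTIVATED — reconciler: reactivated — activity statement-checked at 2026-08-29T09:12:55Z after parking at 2026-08-23T12:36:15Z (operator:999:3080951)
- 2026-09-03T13:36:53Z · DORMANT — reconciler: no traction for 5 d (last activity statement-checked at 2026-08-29T12:54:02Z); parked, not closed — `ledger route dormant route-ValiantsHypothesis-I (operator:999:3326241)

sub-problem: ValiantsHypothesis · status: dormant · opened planner-plancard-ValiantsHypothesis-ValiantsH-390f3137-0 2026-08-15T12:15:36Z · rev 2 · ledger route-ValiantsHypothesis-IntegralOrbits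
GENERATED by the gate from the ledger (D-0016/17). Provers cite these decls: `theorem foo : Summit.ValiantsHypothesis.ValiantsHypothesis.Theses.IntegralOrbits.<Decl> := …` in Summits/ValiantsHypothesis/ValiantsHypothesis/Theorems/<Name>.lean.
-/

namespace Summit.ValiantsHypothesis.ValiantsHypothesis.Theses.IntegralOrbits

open scoped BigOperators Topology Manifold Classical MeasureTheory ProbabilityTheory Matrix InnerProductSpace ComplexConjugate ContinuousMap
open Filter Set Function TopologicalSpace MeasureTheory

attribute [summit_statement] _root_.ValiantsHypothesis

open Literature.PNP

/-- item stmt-ValiantsHypothesis-7677 · crux (kind.auto-crux: conjecture-grade) · rank 0 · open · by planner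
why it might fail: it is constant elimination for determinantal expressions (open: arXiv:2606.25121 §1.2); per_n may have qp-size complex expressions while every sign expression of every N·per_n^d is exponential — exactly the failure of RationalCharacterNF.
sources: arXiv:2606.25121, arXiv:2601.00387, Burgisser2000, Koiran2004, Burgisser2009
[target] VP ℂ = VNP ℂ ⇒ ∃ c n₀, ∀ n ≥ n₀, ∃ m ≤ 2^((log₂ n + c)^c), d ≥ 1, N ≠ 0 and an m×m matrix A
of affine forms over ℤ in the n² variables with every coefficient in {−1,0,1} and det A = N·per_n^d. -/
@[route_item "route-ValiantsHypothesis-IntegralOrbits"]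
def IntDetQP : Prop :=
  Literature.Computability.AlgebraicComplexity.VP ℂ = Literature.Computability.AlgebraicComplexity.VNP ℂ → ∃ c n₀ : ℕ, ∀ n ≥ n₀, ∃ (m d : ℕ) (N : ℤ) (A : Matrix (Fin m) (Fin m) (MvPolynomial (Fin n × Fin n) ℤ)), 1 ≤ d ∧ m ≤ 2 ^ ((Nat.log 2 n + c) ^ c) ∧ N ≠ 0 ∧ (∀ i j, (A i j).totalDegree ≤ 1) ∧ (∀ i j s, |MvPolynomial.coeff s (A i j)| ≤ 1) ∧ A.det = MvPolynomial.C N * Literature.Computability.AlgebraicComplexity.perPoly (Fin n) ℤ ^ d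

/-- item stmt-ValiantsHypothesis-7678 · crux · rank 2 · open · by planner
why it might fail: nothing forces the moduli point of a small expression to be RATIONAL of small height: Rep_m(per_n)//G may have only Galois-conjugate packets (then only the number-field version holds) or only points of astronomic height (Hilbert-10-type behaviour); no existence principle is known.
sources: Burgisser2000, arXiv:2606.25121, Lebruyn2008, arXiv:1411.6786, doi:10.1007/978-1-4939-1590-3_3, MignonRessayre2004
[crux] RATIONAL CHARACTER NORMAL FORM (card (A), Diophantine core): if per_n has an affine
determinantal expression of size m over ℂ, it has a normalised one det(1 + Σ_v (x_v − δ_v) M_v) =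
per_n of size m' ≤ 2^((log₂ m + c)^c) whose tuple (M_v) is absolutely irreducible (words span all
matrices) and whose character tr(M_{w₁}⋯M_{w_ℓ}) lies in ℤ[1/N] with numerators ≤ 2^(h(ℓ+1)),
N-exponents ≤ h(ℓ+1), and N ≤ 2^h, h ≤ 2^((log₂ m + c)^c). [difficulty: open-problem] -/
@[route_item "route-ValiantsHypothesis-IntegralOrbits"]
def RationalCharacterNF : Prop :=
  ∃ c : ℕ, ∀ (n m : ℕ), Literature.Computability.AlgebraicComplexity.HasDetRepr (Literature.Computability.AlgebraicComplexity.perPoly (Fin n) ℂ) m → ∃ (m' N h : ℕ) (M : Fin n × Fin n → Matrix (Fin m') (Fin m') ℂ), m' ≤ 2 ^ ((Nat.log 2 m + c) ^ c) ∧ 1 ≤ N ∧ N ≤ 2 ^ h ∧ h ≤ 2 ^ ((Nat.log 2 m + c) ^ c) ∧ ((1 : Matrix (Fin m') (Fin m') (MvPolynomial (Fin n × Fin n) ℂ)) + ∑ v : Fin n × Fin n, (MvPolynomial.X v - MvPolynomial.C (if v.1 = v.2 then (1 : ℂ) else 0)) • (M v).map (MvPolynomial.C : ℂ →+* MvPolynomial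 (Fin n × Fin n) ℂ)).det = Literature.Computability.AlgebraicComplexity.perPoly (Fin n) ℂ ∧ Submodule.span ℂ (Set.range fun w : List (Fin n × Fin n) => (w.map M).prod) = ⊤ ∧ ∀ w : List (Fin n × Fin n), ∃ (z : ℤ) (e : ℕ), ((w.map M).prod).trace = (z : ℂ) / (N : ℂ) ^ e ∧ |z| ≤ 2 ^ (h * (w.length + 1)) ∧ e ≤ h * (w.length + 1)

/-- item stmt-ValiantsHypothesis-7679 · crux · rank 3 · open · by planner
why it might fail: the qualitative lift is order theory; the risk is the EFFECTIVE part — the Λ-stable lattice is the first stall of the dual chain L_ℓ^#, ℓ ≤ m² + log₂[L^#:L], and the HNF/Gram-determinant bookkeeping must stay polynomial in m+#ι+h (else restate with a worse but still sufficient bound).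
sources: McconnellRobson2001, Lebruyn2008, Reiner2003MaximalOrders, CurtisReiner1962, doi:10.1007/978-1-4939-1590-3_3
[crux] INTEGRAL CHARACTER LIFT (card (B)+(C)+(D)+(E) in one statement): an absolutely irreducible
tuple M : ι → M_m(ℂ) whose character is ℤ[1/N]-valued with numerators ≤ 2^(h(ℓ+1)) and N-exponents ≤
h(ℓ+1) (1 ≤ N ≤ 2^h) admits integer matrices Z_v of size m² with |entries| ≤ 2^((m+#ι+h+2)^c) and e
≤ (m+#ι+h+2)^c such that the generic pencil determinant det(X₀·1 + Σ_v X_v Z_v/N^e) equals det(X₀·1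
+ Σ_v X_v M_v)^r for some r ≥ 1 (proof route: Λ = ℤ[1/N]⟨words⟩ ⊆ Λ^# is an order, left-regular
representation on the Λ-stable free lattice Λ^#, r = m). [difficulty: L] -/
@[route_item "route-ValiantsHypothesis-IntegralOrbits"]
def IntegralCharacterLift : Prop :=
  ∃ c : ℕ, ∀ (ι : Type) [Fintype ι] [DecidableEq ι] (m N h : ℕ) (M : ι → Matrix (Fin m) (Fin m) ℂ), 1 ≤ N → N ≤ 2 ^ h → Submodule.span ℂ (Set.range fun w : List ι => (w.map M).prod) = ⊤ → (∀ w : List ι, ∃ (z : ℤ) (e : ℕ), ((w.map M).prod).trace = (z : ℂ) / (N : ℂ) ^ e ∧ |z| ≤ 2 ^ (h * (w.length + 1)) ∧ e ≤ h * (w.length + 1)) → ∃ (e r : ℕ) (Z : ι → Matrix (Fin m × Fin m) (Fin m × Fin m) ℤ), 1 ≤ r ∧ e ≤ (m + Fintype.card ι + h + 2) ^ c ∧ (∀ v a b, |Z v a b| ≤ 2 ^ ((m + Fintype.card ι + h + 2) ^ c)) ∧ ((MvPolynomial.X none : MvPolynomial (Option ι) ℂ) • (1 : Matrix (Fin m ×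 Fin m) (Fin m × Fin m) (MvPolynomial (Option ι) ℂ)) + ∑ v : ι, (MvPolynomial.X (some v) : MvPolynomial (Option ι) ℂ) • (Z v).map (fun z : ℤ => (MvPolynomial.C ((z : ℂ) / (N : ℂ) ^ e) : MvPolynomial (Option ι) ℂ))).det = (((MvPolynomial.X none : MvPolynomial (Option ι) ℂ) • (1 : Matrix (Fin m) (Fin m) (MvPolynomial (Option ι) ℂ)) + ∑ v : ι, (MvPolynomial.X (some v) : MvPolynomial (Option ι) ℂ) • (M v).map (MvPolynomial.C : ℂ →+* MvPolynomial (Option ι) ℂ)).det) ^ r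

/-- item stmt-ValiantsHypothesis-7680 · crux · rank 4 · closed · proved by Summit.ValiantsHypothesis.ValiantsHypothesis.Theorems.tauBurgisserDet_proof @ 115a53820f95 (prover) · by planner
why it might fail: only if a step of Burgisser2009 is genuinely polynomial-only: the CH collapse needs #P ⊆ qpSIZE ⇒ CH ⊆ qpSIZE (qp∘qp = qp, fine) and the constant-free completeness of per up to 2^p(n) (Koiran2004 Thm 4.3) must be re-run for qp-size VNP⁰-type families; unverified in print.
sources: Burgisser2009, Koiran2004, arXiv:2406.06217, ShubSmale1995, arXiv:2601.00387
[crux] Bürgisser's theorem in the form the assembly needs: the τ-conjecture implies that NO c, n₀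
give, for all n ≥ n₀, sign determinantal expressions of size ≤ 2^((log₂ n + c)^c) of some N·per_n^d
(N ≠ 0, d ≥ 1) — i.e. Burgisser2009 Thm 1.1/1.2 re-run at quasi-polynomial granularity with powers
(Boolean side: exact d-th root of per(x)^d ≥ 0 on 0/1 matrices; algebraic side: (2^p·PW_{2^ℓ})^d·N
keeps its 2^ℓ integer roots) and with the multiplier N as advice. [difficulty: XL] -/
@[route_item "route-ValiantsHypothesis-IntegralOrbits"]
def TauBurgisserDet : Prop :=
  (∃ c : ℕ, ∀ f : Polynomial ℤ, f ≠ 0 → f.roots.toFinset.card ≤ (Literature.Computability.AlgebraicComplexity.constantFreeComplexity ((MvPolynomial.uniqueAlgEquiv ℤ (Fin 1)).symm f) + 2) ^ c) → ¬ ∃ c n₀ : ℕ, ∀ n ≥ n₀, ∃ (m d : ℕ) (N : ℤ) (A : Matrix (Fin m) (Fin m) (MvPolynomial (Fin n × Fin n) ℤ)), 1 ≤ d ∧ m ≤ 2 ^ ((Nat.log 2 n + c) ^ c) ∧ N ≠ 0 ∧ (∀ i j, (A i j).totalDegree ≤ 1) ∧ (∀ i j s, |MvPolynomial.coeff s (A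 i j)| ≤ 1) ∧ A.det = MvPolynomial.C N * Literature.Computability.AlgebraicComplexity.perPoly (Fin n) ℤ ^ d

-- `TauBurgisserDet` holds: proved by `Summit.ValiantsHypothesis.ValiantsHypothesis.Theorems.tauBurgisserDet_proof` @ 115a53820f95 (its module imports this route file, so no `_holds` link can be stated here).

/-- item stmt-ValiantsHypothesis-0336 · crux · rank 5 · open · by planner
why it might fail: false if ∏_{i≤n}(T−i) or some m_n·n! has constant-free SLPs of length (log n)^O(1) (open; best τ(n!) = O(√n log² n)); the real-zero analogue IS false (Chebyshev, barrier TauRealZeros), so integrality must be used.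
sources: ShubSmale1995, BlumCuckerShubSmale1998, arXiv:2406.06217, Koiran2011
[ShubSmale1995; Burgisser2009 §1]: number of distinct integer zeros of f ≠ 0 is polynomial in τ(f).
τ here = constantFreeComplexity (fan-in-2, constants and sum coefficients in {0,±1}) of f
transported to MvPolynomial (Fin 1) ℤ via uniqueAlgEquiv; equals Shub–Smale's τ up to a factor ≤ 3,
absorbed by c. Diophantine input expected (heights, p-adic interpolation à la Strassmann,
Bombieri–Pila type counting). -/
@[route_item "route-ValiantsHypothesis-IntegralOrbits"]
def TauConjecture : Prop :=
  ∃ c : ℕ, ∀ f : Polynomial ℤ, f ≠ 0 → f.roots.toFinset.card ≤ (Literature.Computability.AlgebraicComplexity.constantFreeComplexity ((MvPolynomial.uniqueAlgEquiv ℤ (Fin 1)).symm f) + 2) ^ c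

/-- item stmt-ValiantsHypothesis-7681 · support · rank 9 · closed · proved by Summit.ValiantsHypothesis.ValiantsHypothesis.Theorems.heightToSize_proof @ 736b119332e7 (prover) · by planner
sources: Valiant1979, MahajanVinay1997, arXiv:2406.06217, Toda1991
[support] HEIGHT IS FREE UP TO SIZE: an m×m affine determinantal expression over ℤ (variables σ)
with all coefficients bounded by 2^h of a polynomial f can be replaced by one of size ≤ (m + #σ + h
+ 2)^c with all coefficients in {−1,0,1} (det → ABP with ±1 constants, binary expansion of each edge
constant as a series-parallel gadget, ABP → det with entries in {0,±1,±x}, sign fixed by a row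
swap). [difficulty: provable-now] -/
@[route_item "route-ValiantsHypothesis-IntegralOrbits"]
def HeightToSize : Prop :=
  ∃ c : ℕ, ∀ (σ : Type) [Fintype σ] [DecidableEq σ] (m h : ℕ) (f : MvPolynomial σ ℤ) (A : Matrix (Fin m) (Fin m) (MvPolynomial σ ℤ)), (∀ i j, (A i j).totalDegree ≤ 1) → (∀ i j s, |MvPolynomial.coeff s (A i j)| ≤ 2 ^ h) → A.det = f → ∃ (m' : ℕ) (B : Matrix (Fin m') (Fin m') (MvPolynomial σ ℤ)), m' ≤ (m + Fintype.card σ + h + 2) ^ c ∧ (∀ i j, (B i j).totalDegree ≤ 1) ∧ (∀ i j s, |MvPolynomial.coeff s (B i j)| ≤ 1) ∧ B.det = f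

-- `HeightToSize` holds: proved by `Summit.ValiantsHypothesis.ValiantsHypothesis.Theorems.heightToSize_proof` @ 736b119332e7 (its module imports this route file, so no `_holds` link can be stated here).

/-- item stmt-ValiantsHypothesis-7682 · support · rank 9 · closed · proved by Summit.ValiantsHypothesis.ValiantsHypothesis.Theorems.intDetGlue_proof (prover) · by planner
sources: BurgisserClausenShokrollahi1997, MignonRessayre2004, Valiant1979
[support] layer-1 glue: RationalCharacterNF → IntegralCharacterLift → HeightToSize → IntDetQP. From
VP ℂ = VNP ℂ get qp-bounded dc(per_n) (cone facts
isQPBounded_determinantalComplexity_of_isVPFamily_holds, hasDetRepr_determinantalComplexity_holds,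
mem_VP_ofFintype_iff_holds, perFamily_mem_VNP_holds), apply the NF, lift (ι = Fin n × Fin n),
substitute X₀ ↦ 1, X_v ↦ x_v − δ_v (det commutes with the ring hom), clear N^e row-wise (N' =
N^(e·m'²), d = r), descend from ℂ to ℤ by injectivity of MvPolynomial.map, and compress heights with
HeightToSize; compose the qp bounds. [difficulty: M] -/
@[route_item "route-ValiantsHypothesis-IntegralOrbits"]
def IntDetGlue : Prop :=
  RationalCharacterNF → IntegralCharacterLift → HeightToSize → IntDetQP

-- `IntDetGlue` holds: proved by `Summit.ValiantsHypothesis.ValiantsHypothesis.Theorems.intDetGlue_proof` (its module imports this route file, so no `_holds` link can be stated here).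

-- earlier Assembly (stmt-ValiantsHypothesis-7683, replaced 2026-08-16T16:26:28Z -> stmt-ValiantsHypothesis-16158): proved by Summit.ValiantsHypothesis.Theorems.IntegralOrbits.Assembly_proof @ fa97921f99a9 — IntDetQP → TauConjecture → TauBurgisserDet → ValiantsHypothesis
/-- item stmt-ValiantsHypothesis-16158 · assembly · rank 1 · closed · proved by Summit.ValiantsHypothesis.Theorems.IntegralOrbits.Assembly_proof @ 7cb883da0601 (prover) · by planner
sources: Burgisser2009, ShubSmale1995, Valiant1979
[assembly] Full two-layer assembly: RationalCharacterNF → IntegralCharacterLift → HeightToSize →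
TauConjecture → TauBurgisserDet → ValiantsHypothesis (VP ℂ ≠ VNP ℂ). The engine cruxes (rational
character normal form; integral character lift at ι = Fin n × Fin n) and the proved support
HeightToSize give the target IntDetQP by the layer-1 glue IntDetGlue (substitute X₀ ↦ 1, X_v ↦ x_v −
δ_v in the lifted pencil, clear N^e, descend ℂ → ℤ by injectivity of MvPolynomial.map, compress
heights; landed as Theorems.intDetGlue_proof), and under VP ℂ = VNP ℂ the τ-endgame TauBurgisserDet
applied to TauConjecture denies IntDetQP's conclusion. Provable now in one line from landed
theorems: fun nf lift hs tau tb => closes (intDetGlue_proof nf lift hs) tau tb. (Restated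
2026-08-16: the earlier form IntDetQP → TauConjecture → TauBurgisserDet → ValiantsHypothesis
coincided with the deciding theorem `closes` and was tauto-trivial.) [difficulty: provable-now] -/
@[route_item "route-ValiantsHypothesis-IntegralOrbits"]
def Assembly : Prop :=
  RationalCharacterNF → IntegralCharacterLift → HeightToSize → TauConjecture → TauBurgisserDet → ValiantsHypothesis

-- `Assembly` holds: proved by `Summit.ValiantsHypothesis.Theorems.IntegralOrbits.Assembly_proof` @ 7cb883da0601 (its module imports this route file, so no `_holds` link can be stated here).

/-! D-0027 §2.1 — DECIDING THEOREM (planner-authored via `route open/edit --closes-file`; by planner-rbadge-ValiantsHypothesis-IntegralOrbi-5aa7c13a-g2-0 2026-08-15T16:11:17Z):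
its hypotheses are this route's items and its conclusion the sub-problem Statement (glue_lint), and it elaborates with this file. -/

@[closes "route-ValiantsHypothesis-IntegralOrbits"] theorem closes : IntDetQP → TauConjecture → TauBurgisserDet → _root_.ValiantsHypothesis :=
  fun h_IntDetQP h_TauConjecture h_TauBurgisserDet h_eq =>
    h_TauBurgisserDet h_TauConjecture (h_IntDetQP h_eq)

end Summit.ValiantsHypothesis.ValiantsHypothesis.Theses.IntegralOrbits
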